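import Summits.CriticalPhenomena.CardyFormulaZ2.Theorems.CardyBoundaryCoulombGasStripClusterRatesConfinedGlueTransfer
import HarnessLib

/-!
# END SEPARATION implies two-cluster quasi-multiplicativity in the length

Support file for line `two-cluster-rate-is-stationary-gap` (crux `StripClusterRates`,
stmt-CriticalPhenomena-13878), lead c8, stub `c8_quasiMult_of_sep` (T6a, "SEP ⇒ QM₂").

Let `p₂(m,n)` be the probability (bond percolation on `ℤ²` at `p = 1/2`) that `[0,m]×[0,n]` carries two open
left-right crossings lying in distinct open clusters of the rectangle (`pTwo` of `Negative.KacFromAboveFalse`), and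
let `f(M,b)` be the probability of the END-CONFINED block event on `[0,M]×[0,3b+2]` of lead c6's
`…ConfinedGlueTransfer` (abstracted as a function `f` pinned by the defining equation, exactly as in `cg_f_supermul`).
The END SEPARATION hypothesis SEP says that a plain two-cluster crossing upgrades, at bounded cost `c > 0` and `k ≥ 1`
extra widths of length, to an end-confined one: `c · p₂(M, 3b+2) ≤ f(M + k(3b+2), b)` for `b ≥ b₀`, `M ≥ 1`.
This file records that SEP yields QUASI-MULTIPLICATIVITY of `p₂` in the length at the fixed widths `n = 3b+2`:

  `p₂(m₁, n) · p₂(m₂, n) ≤ C · p₂(m₁ + m₂ + 2k·n, n)`   (`b ≥ max b₀ 3`, `m₁, m₂ ≥ 1`, `C = 1/(c₀ c²)`),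

`c₀` being the absolute gluing constant of `cg_f_supermul`.

Proof. Put `Mᵢ = mᵢ + k·n ≥ n ≥ b + 1`. SEP twice gives `c² p₂(m₁,n) p₂(m₂,n) ≤ f(M₁,b) f(M₂,b)`;
super-multiplicativity of `f` (`cg_f_supermul`, `b ≥ 3`) gives `c₀ f(M₁,b) f(M₂,b) ≤ f(M₁ + b + 2 + M₂, b)`;
`f ≤ p₂` (`cg_f_le_pTwo`); finally `p₂` is ANTITONE in the length (`qms_pTwo_add_le`: `p₂(a + j, n) ≤ p₂(a, n)`, from
sub-multiplicativity `pTwo_submul` and `p₂ ≤ 1`), and `M₁ + b + 2 + M₂ = (m₁ + m₂ + 2k·n) + (b + 2)`.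

No definitions. References: [Nolin2008] §4 (separation of arms and quasi-multiplicativity); [folklore].
-/

noncomputable section

open MeasureTheory Filter Topology Set
open Literature.Probability.LatticeModels Literature.Probability.Percolation
open Summit.CriticalPhenomena.CardyFormulaZ2.Theorems.StripClusterRates.Negative (pOne pTwo rateSeqTwo rateSeqOne)
open Summit.CriticalPhenomena.CardyFormulaZ2.Theorems.StripRates (pTwo_submul)

namespace Summit.CriticalPhenomena.CardyFormulaZ2.Cruxes.StripClusterRates.TwoClusterRateIsStationaryGap

/-! ## §1 `p₂` is antitone in the length -/

/-- **`p₂` is antitone in the length**: `p₂(a + j, n) ≤ p₂(a, n)` for all `a j n` (sub-multiplicativity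
`p₂(a + j' + 1, n) ≤ p₂(a, n) · p₂(j', n)` and `p₂ ≤ 1`). [folklore] -/
theorem qms_pTwo_add_le (a j n : ℕ) : pTwo (a + j) n ≤ pTwo a n := by
  cases j with
  | zero => exact le_rfl
  | succ j =>
    calc pTwo (a + (j + 1)) n = pTwo (a + j + 1) n := by rw [Nat.add_assoc]
      _ ≤ pTwo a n * pTwo j n := pTwo_submul a j n
      _ ≤ pTwo a n * 1 := mul_le_mul_of_nonneg_left measureReal_le_one measureReal_nonneg
      _ = pTwo a n := mul_one _

/-- `p₂` is antitone in the length, `≤` form: `a ≤ a' → p₂(a', n) ≤ p₂(a, n)`. [folklore] -/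
theorem qms_pTwo_antitone_length {a a' : ℕ} (h : a ≤ a') (n : ℕ) : pTwo a' n ≤ pTwo a n := by
  obtain ⟨j, rfl⟩ := Nat.exists_eq_add_of_le h
  exact qms_pTwo_add_le a j n

/-! ## §2 SEP ⇒ quasi-multiplicativity -/

/-- **END SEPARATION implies two-cluster quasi-multiplicativity** (`f` abstracted as in `cg_f_supermul`):
if `c · p₂(M, 3b+2) ≤ f(M + k(3b+2), b)` for `b ≥ b₀`, `M ≥ 1` (`c > 0`, `k ≥ 1`), then with the gluing constant
`c₀` of `cg_f_supermul`, for `b ≥ max b₀ 3` and `m₁, m₂ ≥ 1`,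
`p₂(m₁, 3b+2) · p₂(m₂, 3b+2) ≤ (1/(c₀c²)) · p₂(m₁ + m₂ + 2k(3b+2), 3b+2)`. [cite: Nolin2008, §4] -/
theorem qms_quasiMult (f : ℕ → ℕ → ℝ)
    (hf : f = (fun M b : ℕ => (bondPercolation (zdGraph 2) half).real ((openCrossing {z ∈ (rectangle M (3 * b + 2) : Set (Site 2)) | (z 0 ≤ (b : ℤ) ∨ (M : ℤ) ≤ z 0 + b) → z 1 ≤ (b : ℤ)} (leftSide M (3 * b + 2) : Set (Site 2)) (rightSide M (3 * b + 2) : Set (Site 2)) ∩ tbCrossing b b ∩ openCrossing {z ∈ (rectangle M (3 * b + 2) : Set (Site 2)) | (z 0 ≤ (b : ℤ) ∨ (M : ℤ) ≤ z 0 + b) → 2 * (b : ℤ) + 2 ≤ z 1} (leftSide M (3 * b + 2) : Set (Site 2)) (rightSide M (3 * b + 2) : Set (Site 2)) ∩ (BondConfig.relabel (sym2Equiv (Site.shift (-pt 0 (2 * (b : ℤ) + 2))))) ⁻¹' tbCrossing b b) ∩ (dualConfig ⁻¹' openCrossing {z ∈ ((· + pt (-1) 0) '' (rectangle (M + 1)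 (3 * b + 1) : Set (Site 2))) | (z 0 ≤ (b : ℤ) ∨ (M : ℤ) ≤ z 0 + b) → (b : ℤ) + 1 ≤ z 1 ∧ z 1 ≤ 2 * (b : ℤ)} ((· + pt (-1) 0) '' (leftSide (M + 1) (3 * b + 1) : Set (Site 2))) ((· + pt (-1) 0) '' (rightSide (M + 1) (3 * b + 1) : Set (Site 2)))))))
    (hsep : ∃ c : ℝ, 0 < c ∧ ∃ b₀ k : ℕ, 1 ≤ k ∧ ∀ b : ℕ, b₀ ≤ b → ∀ M : ℕ, 1 ≤ M →
      c * pTwo M (3 * b + 2) ≤ f (M + k * (3 * b + 2)) b) :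
    ∃ C : ℝ, 0 < C ∧ ∃ b₀ k : ℕ, ∀ b : ℕ, b₀ ≤ b → ∀ m₁ m₂ : ℕ, 1 ≤ m₁ → 1 ≤ m₂ →
      pTwo m₁ (3 * b + 2) * pTwo m₂ (3 * b + 2) ≤ C * pTwo (m₁ + m₂ + k * (3 * b + 2)) (3 * b + 2) := by
  obtain ⟨c₀, hc₀, _, hsup⟩ := cg_f_supermul
  obtain ⟨c, hc, b₀, k, hk, hsep⟩ := hsep
  refine ⟨1 / (c₀ * c ^ 2), by positivity, max b₀ 3, 2 * k, fun b hb m₁ m₂ hm₁ hm₂ => ?_⟩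
  have hb₀ : b₀ ≤ b := le_trans (le_max_left _ _) hb
  have hb3 : 3 ≤ b := le_trans (le_max_right _ _) hb
  have hb1 : 1 ≤ b := le_trans (by norm_num) hb3
  set n : ℕ := 3 * b + 2 with hn
  have hkn : n ≤ k * n := Nat.le_mul_of_pos_left n hk
  have hM₁ : b + 1 ≤ m₁ + k * n := by omega
  have hM₂ : b + 1 ≤ m₂ + k * n := by omega
  have hf0 : ∀ M, 0 ≤ f M b := by intro M; rw [hf]; exact measureReal_nonneg
  have hp0 : ∀ m, 0 ≤ pTwo m n := fun _ => measureReal_nonneg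
  have h1 : c * pTwo m₁ n ≤ f (m₁ + k * n) b := hsep b hb₀ m₁ hm₁
  have h2 : c * pTwo m₂ n ≤ f (m₂ + k * n) b := hsep b hb₀ m₂ hm₂
  have h12 : c * pTwo m₁ n * (c * pTwo m₂ n) ≤ f (m₁ + k * n) b * f (m₂ + k * n) b :=
    mul_le_mul h1 h2 (mul_nonneg hc.le (hp0 _)) (hf0 _)
  have h3 : c₀ * f (m₁ + k * n) b * f (m₂ + k * n) b ≤ f (m₁ + k * n + b + 2 + (m₂ + k * n)) b :=
    hsup f hf (m₁ + k * n) (m₂ + k * n) b hb3 hM₁ hM₂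
  have h4 : f (m₁ + k * n + b + 2 + (m₂ + k * n)) b ≤ pTwo (m₁ + k * n + b + 2 + (m₂ + k * n)) n :=
    cg_f_le_pTwo f hf hb1 (by omega)
  have h5 : pTwo (m₁ + k * n + b + 2 + (m₂ + k * n)) n ≤ pTwo (m₁ + m₂ + 2 * k * n) n :=
    qms_pTwo_antitone_length (by ring_nf; omega) n
  have hC : 0 < c₀ * c ^ 2 := by positivity
  have key : c₀ * c ^ 2 * (pTwo m₁ n * pTwo m₂ n) ≤ pTwo (m₁ + m₂ + 2 * k * n) n :=
    calc c₀ * c ^ 2 * (pTwo m₁ n * pTwo m₂ n) = c₀ * (c * pTwo m₁ n * (c * pTwo m₂ n)) := by ring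
      _ ≤ c₀ * (f (m₁ + k * n) b * f (m₂ + k * n) b) := mul_le_mul_of_nonneg_left h12 hc₀.le
      _ = c₀ * f (m₁ + k * n) b * f (m₂ + k * n) b := (mul_assoc _ _ _).symm
      _ ≤ _ := h3
      _ ≤ _ := h4
      _ ≤ _ := h5
  calc pTwo m₁ n * pTwo m₂ n = 1 / (c₀ * c ^ 2) * (c₀ * c ^ 2 * (pTwo m₁ n * pTwo m₂ n)) := by
        rw [one_div, inv_mul_cancel_left₀ hC.ne']
    _ ≤ 1 / (c₀ * c ^ 2) * pTwo (m₁ + m₂ + 2 * k * n) n :=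
        mul_le_mul_of_nonneg_left key (by positivity)

/-- **Registered form** (stub `c8_quasiMult_of_sep` of stmt-CriticalPhenomena-13878, lead c8; T6a): with `f(M,b)` the
probability of the end-confined block event on `[0,M]×[0,3b+2]`, END SEPARATION
(`c · p₂(M, 3b+2) ≤ f(M + k(3b+2), b)`, `b ≥ b₀`, `M ≥ 1`) implies two-cluster quasi-multiplicativity in the length:
`p₂(m₁, 3b+2) p₂(m₂, 3b+2) ≤ C · p₂(m₁ + m₂ + k'(3b+2), 3b+2)` for `b` large and `m₁, m₂ ≥ 1`
(= `qms_quasiMult`, `k' = 2k`, `C = 1/(c₀c²)`). [cite: Nolin2008, §4] -/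
theorem c8_quasiMult_of_sep : ∀ f : ℕ → ℕ → ℝ, f = (fun M b : ℕ => (bondPercolation (zdGraph 2) half).real ((openCrossing {z ∈ (rectangle M (3 * b + 2) : Set (Site 2)) | (z 0 ≤ (b : ℤ) ∨ (M : ℤ) ≤ z 0 + b) → z 1 ≤ (b : ℤ)} (leftSide M (3 * b + 2) : Set (Site 2)) (rightSide M (3 * b + 2) : Set (Site 2)) ∩ tbCrossing b b ∩ openCrossing {z ∈ (rectangle M (3 * b + 2) : Set (Site 2)) | (z 0 ≤ (b : ℤ) ∨ (M : ℤ) ≤ z 0 + b) → 2 * (b : ℤ) + 2 ≤ z 1} (leftSide M (3 * b + 2) : Set (Site 2)) (rightSide M (3 * b + 2) : Set (Site 2)) ∩ (BondConfig.relabel (sym2Equiv (Site.shift (-pt 0 (2 * (b : ℤ) + 2))))) ⁻¹' tbCrossing b b) ∩ (dualConfig ⁻¹' openCrossing {z ∈ ((· + pt (-1) 0) '' (rectangle (M + 1) (3 * b + 1) : Set (Site 2))) | (z 0 ≤ (b : ℤ) ∨ (M : ℤ) ≤ z 0 + b) → (b : ℤ) + 1 ≤ z 1 ∧ z 1 ≤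 2 * (b : ℤ)} ((· + pt (-1) 0) '' (leftSide (M + 1) (3 * b + 1) : Set (Site 2))) ((· + pt (-1) 0) '' (rightSide (M + 1) (3 * b + 1) : Set (Site 2)))))) → (∃ c : ℝ, 0 < c ∧ ∃ b₀ k : ℕ, 1 ≤ k ∧ ∀ b : ℕ, b₀ ≤ b → ∀ M : ℕ, 1 ≤ M → c * pTwo M (3 * b + 2) ≤ f (M + k * (3 * b + 2)) b) → ∃ C : ℝ, 0 < C ∧ ∃ b₀ k : ℕ, ∀ b : ℕ, b₀ ≤ b → ∀ m₁ m₂ : ℕ, 1 ≤ m₁ → 1 ≤ m₂ → pTwo m₁ (3 * b + 2) * pTwo m₂ (3 * b + 2) ≤ C * pTwo (m₁ + m₂ + k * (3 * b + 2)) (3 * b + 2) :=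
  fun f hf hsep => qms_quasiMult f hf hsep

end Summit.CriticalPhenomena.CardyFormulaZ2.Cruxes.StripClusterRates.TwoClusterRateIsStationaryGap

end
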